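import Summits.QuantumAdvantage.QuantumAdvantage.Theorems.SosSandwichQueryAAQMiddleBand
import HarnessLib

/-!
# Route `SosSandwich`, crux `PseudoBoundedAA` (stmt-QuantumAdvantage-15237): `AA_Q` IS ITS DEEP-BAND CASE, for
# every fixed depth `K₀`

Strengthening of `Theorems/SosSandwichQueryAAQMiddleBand.lean` (`K₀ = 2`) by the general bottom rung
(`LevelKRung.exists_influence_ge_levelK`): for EVERY fixed `K₀`, the crux `AA_Q` is equivalent to its restriction to
algorithms whose acceptance polynomial carries at least a third of its variance on the DEEP BAND of Fourier levels
`K₀+1 … 2T-2` — at distance `> K₀` from the bottom and `> 1` from the top (extreme levels are handled with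
constants polynomial in `T` for fixed `K₀`: `(ε/T)^{4K₀-2}` from the bottom rungs, `(ε/T)²` from the top two).

* `aaQuery_levelK_share` — the level-`k` rung in `AA_Q` shape: a share `η` of the variance on level `k` gives
  `16η²·(ε/T)^{4k-2} ≤ 9^{k-1}(2k+1)² 2^{4k-2}·Inf_i`;
* `sum_levels_le_three_bands` — `Σ_{k=1}^{d} W_k ≤ Σ_{k ≤ K₀} W_k + Σ_{K₀ < k ≤ d-2} W_k + (W_{d-1} + W_d)`;
* `aaQuery_of_band` — **deep-band `AA_Q` ⟹ `AA_Q`** for every `K₀`; `band_of_aaQuery`, `aaQuery_iff_band`.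

So the open content of `AA_Q` is influence bounds for bounded quantum acceptance polynomials whose Fourier weight
sits at depth growing with `T` from the bottom (and below the top two levels): exactly where the bottom rung's
`3^k·T^{O(k)}` and the missing top rungs below level `2T-1` bite.

Honest label: a reduction/equivalence (planner-facing); no stub, crux or summit is proved.  Sources: Aaronson–Ambainis
2014 Conj. 6; O'Donnell 2014 §1.4, Thm. 9.21; Escudero Gutiérrez arXiv:2304.06713.
-/

-- D-0017: single-conjunct summit ⇒ the duplicate `QuantumAdvantage.QuantumAdvantage` is mandated.
set_option linter.dupNamespace false

noncomputable section

namespace Summit.QuantumAdvantage.QuantumAdvantage.Theorems.SosSandwich.LevelTwoRung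

open Finset
open Literature.Computability.QuantumComplexity
open Literature.Computability.Complexity.LowDegree (cubeFourierCoeff)
open Literature.Computability.Cryptography (QQueryAlg)
open Summit.QuantumAdvantage.QuantumAdvantage.Theorems.SosSandwich.LevelOneRung
open Summit.QuantumAdvantage.QuantumAdvantage.Theorems.SosSandwich.LevelKRung
  (boolVariance_le_sum_levels boolVariance_eq_sum_nonempty exists_influence_ge_levelK_query)

variable {N : ℕ}

/-! ### The level-`k` rung in `AA_Q` shape -/

/-- **The level-`k` rung in `AA_Q` shape.**  For a `T ≥ 1`-query algorithm on `N` bits, a real polynomial `p` with its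
acceptance probabilities as cube values, `Var[p] ≥ ε > 0` and a share `η > 0` of the variance on level `k ≥ 1`
(`η·Var ≤ W_k`): some variable has `16η²·(ε/T)^{4k-2} ≤ 9^{k-1}(2k+1)²·2^{4k-2}·Inf_i[p]`.
[cite: AaronsonAmbainis2014, Conj. 6] [cite: ODonnell2014, Thm. 9.21] -/
theorem aaQuery_levelK_share {k : ℕ} (hk : 1 ≤ k) (Q : QQueryAlg N) (hT : 1 ≤ Q.queries)
    (p : MvPolynomial (Fin N) ℝ) (hp : ∀ x, evalBool p x = Q.acceptProb x) {ε η : ℝ} (hε : 0 < ε)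
    (hv : ε ≤ boolVariance p) (hη : 0 < η)
    (hshare : η * boolVariance p ≤
      ∑ S ∈ univ.filter (fun S : Finset (Fin N) => S.card = k), cubeFourierCoeff (evalBool p) S ^ 2) :
    ∃ i : Fin N, 16 * η ^ 2 * (ε / Q.queries) ^ (4 * k - 2) ≤
      (9 : ℝ) ^ (k - 1) * (2 * k + 1) ^ 2 * (2 : ℝ) ^ (4 * k - 2) * influence i p := by
  classical
  set W := ∑ S ∈ univ.filter (fun S : Finset (Fin N) => S.card = k), cubeFourierCoeff (evalBool p) S ^ 2 with hW
  rcases Nat.eq_zero_or_pos N with hN0 | hN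
  · exfalso
    subst hN0
    have h0 : boolVariance p = 0 := by
      unfold boolVariance boolAvg
      rw [Fintype.sum_unique, Fintype.sum_unique]
      simp
    linarith
  obtain ⟨i, hi⟩ := exists_influence_ge_levelK_query hk hN Q p hp
  refine ⟨i, ?_⟩
  have hI := influence_nonneg i p
  have hTpos : (0 : ℝ) < Q.queries := by exact_mod_cast hT
  have hT1 : (1 : ℝ) ≤ Q.queries := by exact_mod_cast hT
  have hb : ∀ x, 0 ≤ evalBool p x ∧ evalBool p x ≤ 1 := fun x => acceptPoly_bounded Q p hp x
  have hε1 : ε ≤ 1 := hv.trans (boolVariance_le_one hb)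
  -- `ηε ≤ W`, `(k!)² ≥ 1`
  have hW : η * ε ≤ W := le_trans (mul_le_mul_of_nonneg_left hv hη.le) hshare
  have hW2 : (η * ε) ^ 2 ≤ W ^ 2 := pow_le_pow_left₀ (by positivity) hW 2
  have hfac : (1 : ℝ) ≤ (k.factorial : ℝ) ^ 2 :=
    one_le_pow₀ (by exact_mod_cast Nat.succ_le_of_lt (Nat.factorial_pos k))
  have h16 : 16 * (η * ε) ^ 2 ≤ 16 * (k.factorial : ℝ) ^ 2 * W ^ 2 := by nlinarith [sq_nonneg W]
  -- `(2T)^{4k-2} = 2^{4k-2} T^{4k-2}`, `ε^{4k-2} ≤ ε²`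
  have hsplit : ((2 * Q.queries : ℕ) : ℝ) ^ (4 * k - 2) = (2 : ℝ) ^ (4 * k - 2) * (Q.queries : ℝ) ^ (4 * k - 2) := by
    push_cast; rw [mul_pow]
  rw [hsplit] at hi
  have hεpow : ε ^ (4 * k - 2) ≤ ε ^ 2 := pow_le_pow_of_le_one hε.le hε1 (by omega)
  have hTpow : (0 : ℝ) < (Q.queries : ℝ) ^ (4 * k - 2) := by positivity
  rw [div_pow]
  rw [show 16 * η ^ 2 * (ε ^ (4 * k - 2) / (Q.queries : ℝ) ^ (4 * k - 2)) =
      16 * η ^ 2 * ε ^ (4 * k - 2) / (Q.queries : ℝ) ^ (4 * k - 2) by ring, div_le_iff₀ hTpow]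
  calc 16 * η ^ 2 * ε ^ (4 * k - 2) ≤ 16 * η ^ 2 * ε ^ 2 := by
        exact mul_le_mul_of_nonneg_left hεpow (by positivity)
    _ = 16 * (η * ε) ^ 2 := by ring
    _ ≤ 16 * (k.factorial : ℝ) ^ 2 * W ^ 2 := h16
    _ ≤ (9 : ℝ) ^ (k - 1) * (2 * k + 1) ^ 2 * ((2 : ℝ) ^ (4 * k - 2) * (Q.queries : ℝ) ^ (4 * k - 2)) *
          influence i p := hi
    _ = (9 : ℝ) ^ (k - 1) * (2 * k + 1) ^ 2 * (2 : ℝ) ^ (4 * k - 2) * influence i p *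
          (Q.queries : ℝ) ^ (4 * k - 2) := by ring

/-! ### Covering the levels by three bands -/

/-- For nonnegative level weights: `Σ_{k=1}^{d} W_k ≤ Σ_{k=1}^{K₀} W_k + Σ_{k=K₀+1}^{d-2} W_k + (W_{d-1} + W_d)`.
[folklore] -/
theorem sum_levels_le_three_bands (K₀ d : ℕ) (hd : 2 ≤ d) (W : ℕ → ℝ) (hW : ∀ k, 0 ≤ W k) :
    ∑ k ∈ Finset.Icc 1 d, W k ≤
      ∑ k ∈ Finset.Icc 1 K₀, W k + ∑ k ∈ Finset.Icc (K₀ + 1) (d - 2), W k + (W (d - 1) + W d) := by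
  classical
  -- pointwise: `W k ≤ W k·[k ≤ K₀] + W k·[K₀ < k ≤ d-2] + W k·[d-1 ≤ k]` for `1 ≤ k ≤ d`
  have hpt : ∀ k ∈ Finset.Icc 1 d, W k ≤
      (if k ∈ Finset.Icc 1 K₀ then W k else 0) + (if k ∈ Finset.Icc (K₀ + 1) (d - 2) then W k else 0) +
        (if k ∈ ({d - 1, d} : Finset ℕ) then W k else 0) := by
    intro k hk
    rw [Finset.mem_Icc] at hk
    have h0 := hW k
    by_cases h1 : k ≤ K₀
    · rw [if_pos (Finset.mem_Icc.mpr ⟨hk.1, h1⟩)]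
      split_ifs <;> linarith
    · by_cases h2 : k ≤ d - 2
      · rw [if_neg (fun h => h1 (Finset.mem_Icc.mp h).2), if_pos (Finset.mem_Icc.mpr ⟨by omega, h2⟩)]
        split_ifs <;> linarith
      · have h3 : k ∈ ({d - 1, d} : Finset ℕ) := by
          rw [Finset.mem_insert, Finset.mem_singleton]; omega
        rw [if_neg (fun h => h1 (Finset.mem_Icc.mp h).2), if_neg (fun h => h2 (Finset.mem_Icc.mp h).2), if_pos h3]
        linarith
  refine (Finset.sum_le_sum hpt).trans ?_
  rw [Finset.sum_add_distrib, Finset.sum_add_distrib]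
  have hA : ∑ k ∈ Finset.Icc 1 d, (if k ∈ Finset.Icc 1 K₀ then W k else 0) ≤ ∑ k ∈ Finset.Icc 1 K₀, W k := by
    rw [← Finset.sum_filter]
    exact Finset.sum_le_sum_of_subset_of_nonneg (fun k hk => (Finset.mem_filter.mp hk).2) fun k _ _ => hW k
  have hB : ∑ k ∈ Finset.Icc 1 d, (if k ∈ Finset.Icc (K₀ + 1) (d - 2) then W k else 0) ≤
      ∑ k ∈ Finset.Icc (K₀ + 1) (d - 2), W k := by
    rw [← Finset.sum_filter]
    exact Finset.sum_le_sum_of_subset_of_nonneg (fun k hk => (Finset.mem_filter.mp hk).2) fun k _ _ => hW k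
  have hC : ∑ k ∈ Finset.Icc 1 d, (if k ∈ ({d - 1, d} : Finset ℕ) then W k else 0) ≤ W (d - 1) + W d := by
    rw [← Finset.sum_filter]
    have hne : d - 1 ≠ d := by omega
    calc ∑ k ∈ (Finset.Icc 1 d).filter (fun k => k ∈ ({d - 1, d} : Finset ℕ)), W k
        ≤ ∑ k ∈ ({d - 1, d} : Finset ℕ), W k :=
          Finset.sum_le_sum_of_subset_of_nonneg (fun k hk => (Finset.mem_filter.mp hk).2) fun k _ _ => hW k
      _ = W (d - 1) + W d := by
          rw [Finset.sum_insert (by rw [Finset.mem_singleton]; exact hne), Finset.sum_singleton]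
  linarith

/-! ### Deep-band `AA_Q` ⟹ `AA_Q`, for every fixed depth `K₀` -/
set_option maxHeartbeats 400000 in
/-- **Deep-band `AA_Q` ⟹ `AA_Q`, for every `K₀`.**  HYPOTHESIS: `AA_Q` asserted only for algorithms with `T ≥ 3`
queries whose acceptance polynomial has at least a THIRD of its variance on the levels `K₀+1 … 2T-2`.  CONCLUSION:
`AA_Q`.  Cases (`T ≥ 3`): a third of the variance on the bottom levels `1 … K₀` (pigeonhole + `aaQuery_levelK_share`,
exponent `4K₀-2`), on the band (hypothesis), or on the top two levels (`twoTopLevels_rung_robust`, exponent `2`);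
`T ≤ 2` by `aaQuery_of_queries_le_two`. [cite: AaronsonAmbainis2014, Conj. 6] [cite: ODonnell2014, Thm. 9.21] -/
theorem aaQuery_of_band (K₀ : ℕ)
    (hBand : ∃ (c : ℕ) (C : ℝ), 0 < C ∧ ∀ (N : ℕ) (Q : QQueryAlg N) (p : MvPolynomial (Fin N) ℝ) (ε : ℝ),
      3 ≤ Q.queries → (∀ x, evalBool p x = Q.acceptProb x) → 0 < ε → ε ≤ boolVariance p →
      boolVariance p ≤ 3 * ∑ k ∈ Finset.Icc (K₀ + 1) (2 * Q.queries - 2),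
        ∑ S ∈ univ.filter (fun S : Finset (Fin N) => S.card = k), cubeFourierCoeff (evalBool p) S ^ 2 →
        ∃ i : Fin N, C * (ε / Q.queries) ^ c ≤ influence i p) :
    ∃ (c : ℕ) (C : ℝ), 0 < C ∧ ∀ (N : ℕ) (Q : QQueryAlg N) (p : MvPolynomial (Fin N) ℝ) (ε : ℝ),
      1 ≤ Q.queries → (∀ x, evalBool p x = Q.acceptProb x) → 0 < ε → ε ≤ boolVariance p →
        ∃ i : Fin N, C * (ε / Q.queries) ^ c ≤ influence i p := by
  classical
  obtain ⟨c, C, hC, H⟩ := hBand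
  obtain ⟨c₂, C₂, hC₂, H₂⟩ := (aaQuery_of_queries_le_two : ∃ (c : ℕ) (C : ℝ), 0 < C ∧
    ∀ (N : ℕ) (Q : QQueryAlg N) (p : MvPolynomial (Fin N) ℝ) (ε : ℝ),
      Q.queries ≤ 2 → 1 ≤ Q.queries → (∀ x, evalBool p x = Q.acceptProb x) → 0 < ε → ε ≤ boolVariance p →
        ∃ i : Fin N, C * (ε / Q.queries) ^ c ≤ influence i p)
  -- the bottom constant: `C_B = 16 / (9 (K₀+1)² 9^{K₀} (2K₀+3)² 2^{4K₀+2})` serves every level `k ≤ K₀`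
  set Γ : ℝ := (9 : ℝ) ^ K₀ * (2 * (K₀ : ℝ) + 3) ^ 2 * (2 : ℝ) ^ (4 * K₀ + 2) with hΓ
  have hΓpos : 0 < Γ := by positivity
  set CB : ℝ := 16 / (9 * ((K₀ : ℝ) + 1) ^ 2 * Γ) with hCB
  have hCBpos : 0 < CB := by positivity
  refine ⟨max (max c c₂) (max 2 (4 * K₀ + 2)), min (min C C₂) (min (1 / 144) CB), by positivity,
    fun N Q p ε hT hp hε hv => ?_⟩
  set c' := max (max c c₂) (max 2 (4 * K₀ + 2)) with hc'
  set C' := min (min C C₂) (min (1 / 144 : ℝ) CB) with hC'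
  have hC'pos : 0 < C' := by positivity
  have hTpos : (0 : ℝ) < Q.queries := by exact_mod_cast hT
  have hb : ∀ x, 0 ≤ evalBool p x ∧ evalBool p x ≤ 1 := fun x => acceptPoly_bounded Q p hp x
  have hv1 : boolVariance p ≤ 1 := boolVariance_le_one hb
  have hε1 : ε ≤ 1 := hv.trans hv1
  have hx1 : ε / Q.queries ≤ 1 := by
    rw [div_le_one hTpos]
    have : (1 : ℝ) ≤ Q.queries := by exact_mod_cast hT
    linarith
  have hx0 : 0 ≤ ε / Q.queries := by positivity
  have mono : ∀ {C₀ : ℝ} {c₀ : ℕ} {I : ℝ}, C' ≤ C₀ → c₀ ≤ c' → C₀ * (ε / Q.queries) ^ c₀ ≤ I →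
      C' * (ε / Q.queries) ^ c' ≤ I := by
    intro C₀ c₀ I hCC hcc hI
    have hpow : (ε / Q.queries) ^ c' ≤ (ε / Q.queries) ^ c₀ := pow_le_pow_of_le_one hx0 hx1 hcc
    calc C' * (ε / Q.queries) ^ c' ≤ C₀ * (ε / Q.queries) ^ c₀ :=
          mul_le_mul hCC hpow (by positivity) (hC'pos.le.trans hCC)
      _ ≤ I := hI
  rcases Nat.lt_or_ge Q.queries 3 with hT2 | hT3
  · -- `T ≤ 2`
    obtain ⟨i, hi⟩ := H₂ N Q p ε (by omega) hT hp hε hv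
    exact ⟨i, mono (by rw [hC']; exact (min_le_left _ _).trans (min_le_right _ _))
      (by rw [hc']; exact (le_max_right _ _).trans (le_max_left _ _)) hi⟩
  -- `T ≥ 3`, `d = 2T ≥ 6`: three bands
  rcases Nat.eq_zero_or_pos N with hN0 | hN
  · exfalso
    subst hN0
    have h0 : boolVariance p = 0 := by
      unfold boolVariance boolAvg
      rw [Fintype.sum_unique, Fintype.sum_unique]
      simp
    linarith
  set W : ℕ → ℝ := fun k =>
    ∑ S ∈ univ.filter (fun S : Finset (Fin N) => S.card = k), cubeFourierCoeff (evalBool p) S ^ 2 with hW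
  have hW0 : ∀ k, 0 ≤ W k := fun k => Finset.sum_nonneg fun S _ => sq_nonneg _
  have hsum : boolVariance p ≤ ∑ k ∈ Finset.Icc 1 (2 * Q.queries), W k :=
    boolVariance_le_sum_levels p fun S hS => cubeFourierCoeff_acceptPoly_eq_zero Q p hp hS
  have hcov := sum_levels_le_three_bands K₀ (2 * Q.queries) (by omega) W hW0
  have hV0 := boolVariance_nonneg p
  by_cases hband : boolVariance p ≤ 3 * ∑ k ∈ Finset.Icc (K₀ + 1) (2 * Q.queries - 2), W k
  · obtain ⟨i, hi⟩ := H N Q p ε hT3 hp hε hv hband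
    exact ⟨i, mono (by rw [hC']; exact (min_le_left _ _).trans (min_le_left _ _))
      (by rw [hc']; exact (le_max_left _ _).trans (le_max_left _ _)) hi⟩
  push Not at hband
  by_cases htop : boolVariance p ≤ 3 * (W (2 * Q.queries - 1) + W (2 * Q.queries))
  · -- top two levels: `(1/3)·Var ≤ W_{2T} + W_{2T-1}`
    have hmass : (1 / 3 : ℝ) * boolVariance p ≤ W (2 * Q.queries) + W (2 * Q.queries - 1) := by linarith
    obtain ⟨i, hi⟩ := QueryTopLevel.twoTopLevels_rung_robust Q (by omega) p hp
      (by norm_num : (0 : ℝ) ≤ 1 / 3) hmass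
    refine ⟨i, mono (C₀ := 1 / 144) (c₀ := 2)
      (by rw [hC']; exact (min_le_right _ _).trans (min_le_left _ _))
      (by rw [hc']; exact (le_max_left _ _).trans (le_max_right _ _)) ?_⟩
    have hI := influence_nonneg i p
    have hε2 : ε ^ 2 ≤ boolVariance p ^ 2 := pow_le_pow_left₀ hε.le hv 2
    have hT2 : (1 : ℝ) ≤ (Q.queries : ℝ) ^ 2 := one_le_pow₀ (by exact_mod_cast hT)
    rw [div_pow, show (1 / 144 : ℝ) * (ε ^ 2 / (Q.queries : ℝ) ^ 2) = ε ^ 2 / (144 * (Q.queries : ℝ) ^ 2) by ring,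
      div_le_iff₀ (by positivity)]
    have h1 : boolVariance p ^ 2 ≤ 144 * influence i p := by
      have hi' := hi
      norm_num at hi'
      linarith
    have h2 : 144 * influence i p ≤ influence i p * (144 * (Q.queries : ℝ) ^ 2) := by
      nlinarith [mul_le_mul_of_nonneg_left hT2 hI]
    linarith [hε2, h1, h2]
  · -- bottom levels `1 … K₀` carry a third of the variance; pigeonhole
    push Not at htop
    have hbot : boolVariance p ≤ 3 * ∑ k ∈ Finset.Icc 1 K₀, W k := by
      have e1 : 2 * Q.queries - 2 + 1 = 2 * Q.queries - 1 := by omega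
      linarith [hsum, hcov]
    have hK₀ : 1 ≤ K₀ := by
      by_contra h0
      have : K₀ = 0 := by omega
      subst this
      simp at hbot
      linarith
    have hne : (Finset.Icc 1 K₀).Nonempty := ⟨1, Finset.mem_Icc.mpr ⟨le_rfl, hK₀⟩⟩
    have hpig : ∃ k ∈ Finset.Icc 1 K₀, boolVariance p / (3 * K₀) ≤ W k := by
      apply Finset.exists_le_of_sum_le hne
      rw [Finset.sum_const, Nat.card_Icc, nsmul_eq_mul, show K₀ + 1 - 1 = K₀ by omega]
      have hK : (0 : ℝ) < K₀ := by exact_mod_cast hK₀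
      have : (K₀ : ℝ) * (boolVariance p / (3 * K₀)) = boolVariance p / 3 := by field_simp
      rw [this]
      linarith
    obtain ⟨k, hk, hWk⟩ := hpig
    rw [Finset.mem_Icc] at hk
    have hK : (0 : ℝ) < K₀ := by exact_mod_cast hK₀
    have hshare : (1 / (3 * K₀) : ℝ) * boolVariance p ≤ W k := by
      rw [show (1 / (3 * K₀) : ℝ) * boolVariance p = boolVariance p / (3 * K₀) by ring]; exact hWk
    obtain ⟨i, hi⟩ := aaQuery_levelK_share hk.1 Q hT p hp hε hv (by positivity) hshare
    refine ⟨i, mono (C₀ := CB) (c₀ := 4 * K₀ + 2)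
      (by rw [hC']; exact (min_le_right _ _).trans (min_le_right _ _))
      (by rw [hc']; exact (le_max_right _ _).trans (le_max_right _ _)) ?_⟩
    -- from the level-`k` rung (`k ≤ K₀`) to the uniform bottom constant
    have hI := influence_nonneg i p
    have h9 : (9 : ℝ) ^ (k - 1) ≤ (9 : ℝ) ^ K₀ := pow_le_pow_right₀ (by norm_num) (by omega)
    have hk2 : ((2 : ℝ) * k + 1) ^ 2 ≤ (2 * (K₀ : ℝ) + 3) ^ 2 := by
      have : (k : ℝ) ≤ K₀ := by exact_mod_cast hk.2
      nlinarith
    have h2 : (2 : ℝ) ^ (4 * k - 2) ≤ (2 : ℝ) ^ (4 * K₀ + 2) := pow_le_pow_right₀ (by norm_num) (by omega)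
    have hconst : (9 : ℝ) ^ (k - 1) * (2 * k + 1) ^ 2 * (2 : ℝ) ^ (4 * k - 2) ≤ Γ := by
      rw [hΓ]; gcongr
    have hpow : (ε / Q.queries) ^ (4 * K₀ + 2) ≤ (ε / Q.queries) ^ (4 * k - 2) :=
      pow_le_pow_of_le_one hx0 hx1 (by omega)
    -- `16 (1/(3K₀))² x^{4k-2} ≤ Γ_k Inf ≤ Γ Inf`
    have step : 16 * (1 / (3 * K₀) : ℝ) ^ 2 * (ε / Q.queries) ^ (4 * K₀ + 2) ≤ Γ * influence i p := by
      calc 16 * (1 / (3 * K₀) : ℝ) ^ 2 * (ε / Q.queries) ^ (4 * K₀ + 2)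
          ≤ 16 * (1 / (3 * K₀) : ℝ) ^ 2 * (ε / Q.queries) ^ (4 * k - 2) :=
            mul_le_mul_of_nonneg_left hpow (by positivity)
        _ ≤ (9 : ℝ) ^ (k - 1) * (2 * k + 1) ^ 2 * (2 : ℝ) ^ (4 * k - 2) * influence i p := hi
        _ ≤ Γ * influence i p := mul_le_mul_of_nonneg_right hconst hI
    have hxp : 0 ≤ (ε / Q.queries) ^ (4 * K₀ + 2) := by positivity
    have hCB_le : CB ≤ 16 * (1 / (3 * K₀) : ℝ) ^ 2 / Γ := by
      have e2 : 16 * (1 / (3 * (K₀ : ℝ))) ^ 2 / Γ = 16 / (9 * (K₀ : ℝ) ^ 2 * Γ) := by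
        field_simp
        norm_num
      have hb : (0 : ℝ) < 9 * ((K₀ : ℝ) + 1) ^ 2 * Γ := by positivity
      have hd : (0 : ℝ) < 9 * (K₀ : ℝ) ^ 2 * Γ := mul_pos (mul_pos (by norm_num) (pow_pos hK 2)) hΓpos
      rw [hCB, e2, div_le_div_iff_of_pos_left (by norm_num) hb hd]
      have hsq : (K₀ : ℝ) ^ 2 ≤ ((K₀ : ℝ) + 1) ^ 2 := by nlinarith
      exact mul_le_mul_of_nonneg_right (mul_le_mul_of_nonneg_left hsq (by norm_num)) hΓpos.le
    calc CB * (ε / Q.queries) ^ (4 * K₀ + 2)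
        ≤ 16 * (1 / (3 * K₀) : ℝ) ^ 2 / Γ * (ε / Q.queries) ^ (4 * K₀ + 2) :=
          mul_le_mul_of_nonneg_right hCB_le hxp
      _ ≤ influence i p := by
          rw [div_mul_eq_mul_div, div_le_iff₀ hΓpos, mul_comm (influence i p) Γ]
          exact step

/-- **The converse (restriction): `AA_Q` ⟹ deep-band `AA_Q`.** [cite: AaronsonAmbainis2014, Conj. 6] -/
theorem band_of_aaQuery (K₀ : ℕ)
    (hAAQ : ∃ (c : ℕ) (C : ℝ), 0 < C ∧ ∀ (N : ℕ) (Q : QQueryAlg N) (p : MvPolynomial (Fin N) ℝ) (ε : ℝ),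
      1 ≤ Q.queries → (∀ x, evalBool p x = Q.acceptProb x) → 0 < ε → ε ≤ boolVariance p →
        ∃ i : Fin N, C * (ε / Q.queries) ^ c ≤ influence i p) :
    ∃ (c : ℕ) (C : ℝ), 0 < C ∧ ∀ (N : ℕ) (Q : QQueryAlg N) (p : MvPolynomial (Fin N) ℝ) (ε : ℝ),
      3 ≤ Q.queries → (∀ x, evalBool p x = Q.acceptProb x) → 0 < ε → ε ≤ boolVariance p →
      boolVariance p ≤ 3 * ∑ k ∈ Finset.Icc (K₀ + 1) (2 * Q.queries - 2),
        ∑ S ∈ univ.filter (fun S : Finset (Fin N) => S.card = k), cubeFourierCoeff (evalBool p) S ^ 2 →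
        ∃ i : Fin N, C * (ε / Q.queries) ^ c ≤ influence i p := by
  obtain ⟨c, C, hC, H⟩ := hAAQ
  exact ⟨c, C, hC, fun N Q p ε hT hp hε hv _ => H N Q p ε (by omega) hp hε hv⟩

/-- **`AA_Q` ⟺ deep-band `AA_Q`, for every fixed depth `K₀`.** [cite: AaronsonAmbainis2014, Conj. 6]
[cite: ODonnell2014, §1.4] -/
theorem aaQuery_iff_band (K₀ : ℕ) :
    (∃ (c : ℕ) (C : ℝ), 0 < C ∧ ∀ (N : ℕ) (Q : QQueryAlg N) (p : MvPolynomial (Fin N) ℝ) (ε : ℝ),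
      1 ≤ Q.queries → (∀ x, evalBool p x = Q.acceptProb x) → 0 < ε → ε ≤ boolVariance p →
        ∃ i : Fin N, C * (ε / Q.queries) ^ c ≤ influence i p) ↔
    (∃ (c : ℕ) (C : ℝ), 0 < C ∧ ∀ (N : ℕ) (Q : QQueryAlg N) (p : MvPolynomial (Fin N) ℝ) (ε : ℝ),
      3 ≤ Q.queries → (∀ x, evalBool p x = Q.acceptProb x) → 0 < ε → ε ≤ boolVariance p →
      boolVariance p ≤ 3 * ∑ k ∈ Finset.Icc (K₀ + 1) (2 * Q.queries - 2),
        ∑ S ∈ univ.filter (fun S : Finset (Fin N) => S.card = k), cubeFourierCoeff (evalBool p) S ^ 2 →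
        ∃ i : Fin N, C * (ε / Q.queries) ^ c ≤ influence i p) :=
  ⟨band_of_aaQuery K₀, aaQuery_of_band K₀⟩

end Summit.QuantumAdvantage.QuantumAdvantage.Theorems.SosSandwich.LevelTwoRung
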